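import Literature.Probability.RandomPlanarGeometry.SAWTriangularBridgeTransfer
import Literature.Probability.RandomPlanarGeometry.SAWKestenInequalityAbstractNoGrowth
import Literature.Probability.RandomPlanarGeometry.SAWTriangularBridgeConstant
import Literature.Probability.RandomPlanarGeometry.SAWTriangularDetourDensity
import Literature.Probability.RandomPlanarGeometry.SAWRatioLimitStepOne
import Mathlib.Analysis.SpecialFunctions.Log.Base
import HarnessLib

/-!
# Kesten's ratio limit theorem for BRIDGES of the triangular lattice: `b_{N+1}(𝕋)/b_N(𝕋) → μ(𝕋)`

Topic `Literature/Probability/RandomPlanarGeometry` (lane «pcv-sawmu», door C4 «TRI-BRIDGE-RATIO»; end of the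
chain `SAWTriangularBridgeSurgery` → `SAWTriangularBridgeTransfer` → this file). Sources: H. Kesten, *On the
number of self-avoiding walks*, J. Math. Phys. 4 (1963) 960–969; N. Madras, G. Slade, *The Self-Avoiding Walk*
(1993), Lemma 7.3.1, Theorem 7.3.2 and **Theorem 7.3.4(d)** (book p. 248): "`lim_{N→∞} b_{N+1}/b_N = μ`" —
PRINTED for `ℤ^d`, where the proof (pp. 248–249) needs the renewal structure of bridges (irreducible bridges,
Kesten's relation (4.2.4)) because only the TWO-step ratio is accessible by a pattern surgery on a bipartite
lattice (tree: `Zd.MadrasSlade1993_thm734d_of_eq7313`); and the p. 244 Remark (one-step surgery on `𝕋`).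
On `𝕋` the one-step detour surgery acts on bridges directly (`SAWTriangularBridgeSurgery.lean`), so Kesten's
argument gives the ONE-step bridge ratio without renewal theory. Not located in print for `𝕋` (lane
literature cell (3), a-idea-1 DOORS-DAY3 C4).

## The pieces (all in the tree or in this chain)

* (i) `b_N(𝕋)^{1/N} → μ(𝕋)`: `tendsto_brickBridgeCount_rpow` (`SAWTriangularBridgeConstant.lean`, from the
  Hammersley–Welsh sandwich `e^{−15√N} μ^N ≤ b_N ≤ μ^N`);
* (ii) `b_N ≤ b_{N+1}`: `brickBridgeCount_le_succ`;
* (iii) Kesten's inequality `φ_N² − D/N ≤ φ_N φ_{N+1}`, `φ_N = b_{N+1}/b_N`: the abstract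
  `kesten_ineq_of_transfer_noGrowth` (no a-priori bound on `b_{N+1}/b_N` is needed) fed with
  (P1)/(P2) = `triBridgeKesten_P1`/`triBridgeKesten_P2` and (P3) = `triBridgeKesten_P3` below — the detour
  density for bridges, from the all-walk exponential density `detourDensityTri` and the bridge lower envelope
  `exp_neg_mul_pow_le_brickBridgeCount` (the rare walks are exponentially few, bridges are only
  stretched-exponentially fewer than walks);
* the step `(i)+(ii)+(iii) ⇒ ratio limit` is the tree's `Zd.tendsto_ratio_of_kesten_one` (Madras–Slade Lemma 7.3.1,
  one-step form).

## Contents (namespace `Literature.Probability.RandomPlanarGeometry.SAW`)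

* `half_pow_mul_cube_le'`, `exists_half_pow_mul_exp_sqrt_le` — the elementary tails
  `(1/2)^{⌊N/Q⌋} N³ ≤ 27Q³`, `(1/2)^{⌊N/Q⌋} e^{15√N} N³ ≤ 216 Q³` (large `N`);
* `triBridgeKesten_P3` — (P3) for bridges; `kestenIneqTriBridge` — (iii);
* **`tendsto_brickBridgeCount_ratio : b_{N+1}(𝕋)/b_N(𝕋) → μ(𝕋)`** (`μ(𝕋) = exp logMuTri`).
-/

noncomputable section

open Finset Filter Topology Literature.Probability.LatticeModels Literature.Probability.Percolation SimpleGraph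

namespace Literature.Probability.RandomPlanarGeometry.SAW

/-! ### Elementary tails -/

/-- `(k+1)³ ≤ 27 · 2^k`. [folklore] -/
private theorem succ_pow_three_le_two_pow' : ∀ k : ℕ, (k + 1) ^ 3 ≤ 27 * 2 ^ k
  | 0 => by norm_num
  | 1 => by norm_num
  | 2 => by norm_num
  | 3 => by norm_num
  | k + 4 => by
    have ih := succ_pow_three_le_two_pow' (k + 3)
    have h1 : (k + 4 + 1) ^ 3 ≤ 2 * (k + 3 + 1) ^ 3 := by
      have : (k + 5) ^ 3 ≤ 2 * (k + 4) ^ 3 := by nlinarith [sq_nonneg k, Nat.zero_le k]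
      simpa using this
    calc (k + 4 + 1) ^ 3 ≤ 2 * (k + 3 + 1) ^ 3 := h1
      _ ≤ 2 * (27 * 2 ^ (k + 3)) := Nat.mul_le_mul_left 2 ih
      _ = 27 * 2 ^ (k + 4) := by ring

/-- `(1/2)^{⌊N/Q⌋} · N³ ≤ 27 Q³` (`Q ≥ 1`; the tree's private `half_pow_div_mul_cube_le`, restated).
[folklore] -/
private theorem half_pow_mul_cube_le' {Q : ℕ} (hQ : 0 < Q) (N : ℕ) :
    (1 / 2 : ℝ) ^ (N / Q) * (N : ℝ) ^ 3 ≤ 27 * (Q : ℝ) ^ 3 := by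
  set k := N / Q with hk
  have hN : N ≤ Q * (k + 1) := (Nat.lt_mul_div_succ N hQ).le
  have h1 : (N : ℝ) ^ 3 ≤ ((Q : ℝ) * ((k : ℝ) + 1)) ^ 3 := by
    have : ((N ^ 3 : ℕ) : ℝ) ≤ (((Q * (k + 1)) ^ 3 : ℕ) : ℝ) := by
      exact_mod_cast Nat.pow_le_pow_left hN 3
    push_cast at this
    exact this
  have h2 : ((k : ℝ) + 1) ^ 3 ≤ 27 * 2 ^ k := by
    exact_mod_cast succ_pow_three_le_two_pow' k
  have h3 : (0 : ℝ) < 2 ^ k := by positivity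
  rw [one_div_pow, div_mul_eq_mul_div, one_mul, div_le_iff₀ h3, mul_pow] at *
  calc (N : ℝ) ^ 3 ≤ (Q : ℝ) ^ 3 * ((k : ℝ) + 1) ^ 3 := h1
    _ ≤ (Q : ℝ) ^ 3 * (27 * 2 ^ k) := mul_le_mul_of_nonneg_left h2 (by positivity)
    _ = 27 * (Q : ℝ) ^ 3 * 2 ^ k := by ring

/-- `(1/2)^{⌊N/Q⌋} · e^{15√N} ≤ 1` for `N ≥ (62Q)²` (`⌊N/Q⌋ ≥ N/Q − 1`, `log 2 ≥ 1/2`, and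
`N/Q − 1 ≥ 30√N` once `√N ≥ 31 Q`). [folklore] -/
private theorem half_pow_mul_exp_sqrt_le_one {Q : ℕ} (hQ : 0 < Q) {N : ℕ} (hN : (31 * Q) ^ 2 ≤ N) :
    (1 / 2 : ℝ) ^ (N / Q) * Real.exp (15 * Real.sqrt N) ≤ 1 := by
  set k := N / Q with hk
  have hQr : (0 : ℝ) < Q := by exact_mod_cast hQ
  -- `k ≥ N/Q − 1`
  have hk1 : (N : ℝ) / Q - 1 ≤ k := by
    have h : N < Q * (k + 1) := Nat.lt_mul_div_succ N hQ
    have h' : (N : ℝ) < Q * ((k : ℝ) + 1) := by exact_mod_cast h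
    rw [div_sub_one hQr.ne', div_le_iff₀ hQr]
    linarith
  -- `√N ≥ 31 Q ≥ 31`, so `N/Q − 1 ≥ 30 √N`
  have hsq : (31 : ℝ) * Q ≤ Real.sqrt N := by
    have h : (((31 * Q) ^ 2 : ℕ) : ℝ) ≤ N := by exact_mod_cast hN
    push_cast at h
    rw [show (31 : ℝ) * Q = Real.sqrt (((31 : ℝ) * Q) ^ 2) by rw [Real.sqrt_sq (by positivity)]]
    exact Real.sqrt_le_sqrt h
  have hs1 : (1 : ℝ) ≤ Real.sqrt N := le_trans (by
    have : (1 : ℝ) ≤ Q := by exact_mod_cast hQ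
    linarith) hsq
  have hmain : 30 * Real.sqrt N ≤ (N : ℝ) / Q - 1 := by
    set s := Real.sqrt (N : ℝ) with hs
    have hNr : (N : ℝ) = s * s := (Real.mul_self_sqrt (Nat.cast_nonneg N)).symm
    rw [le_sub_iff_add_le, le_div_iff₀ hQr, hNr]
    -- `(30 s + 1) Q ≤ s · s` from `s ≥ 31 Q` and `s ≥ 1`
    have hQle : (Q : ℝ) * 31 ≤ s := by linarith
    nlinarith
  -- `(1/2)^k = exp(−k log 2) ≤ exp(−15 √N)`
  have hlog2 : (1 / 2 : ℝ) < Real.log 2 := by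
    have := Real.log_two_gt_d9; linarith
  have hpow : (1 / 2 : ℝ) ^ k = Real.exp (-(k * Real.log 2)) := by
    rw [one_div, inv_pow, Real.exp_neg, Real.exp_nat_mul, Real.exp_log (by norm_num : (0 : ℝ) < 2)]
  rw [hpow, ← Real.exp_add]
  refine Real.exp_le_one_iff.2 ?_
  have hk0 : (0 : ℝ) ≤ k := Nat.cast_nonneg _
  nlinarith

/-- **The bridge tail**: for `N ≥ (62Q)²`, `(1/2)^{⌊N/Q⌋} · e^{15√N} · N³ ≤ 216 Q³` (split `⌊N/Q⌋ ≥ 2⌊N/(2Q)⌋`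
and use the two previous bounds with `2Q`). [folklore] -/
private theorem half_pow_mul_exp_sqrt_mul_cube_le {Q : ℕ} (hQ : 0 < Q) {N : ℕ} (hN : (31 * (2 * Q)) ^ 2 ≤ N) :
    (1 / 2 : ℝ) ^ (N / Q) * Real.exp (15 * Real.sqrt N) * (N : ℝ) ^ 3 ≤ 216 * (Q : ℝ) ^ 3 := by
  have hQ2 : 0 < 2 * Q := by omega
  have hdiv : 2 * (N / (2 * Q)) ≤ N / Q := by
    rw [Nat.le_div_iff_mul_le hQ]
    calc 2 * (N / (2 * Q)) * Q = N / (2 * Q) * (2 * Q) := by ring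
      _ ≤ N := Nat.div_mul_le_self N (2 * Q)
  have hhalf : (1 / 2 : ℝ) ^ (N / Q) ≤ (1 / 2 : ℝ) ^ (N / (2 * Q)) * (1 / 2 : ℝ) ^ (N / (2 * Q)) := by
    rw [← pow_add, ← two_mul]
    exact pow_le_pow_of_le_one (by norm_num) (by norm_num) hdiv
  have h1 := half_pow_mul_exp_sqrt_le_one hQ2 hN
  have h2 := half_pow_mul_cube_le' hQ2 N
  have hA : 0 ≤ (1 / 2 : ℝ) ^ (N / (2 * Q)) * Real.exp (15 * Real.sqrt N) := by positivity
  have hB : 0 ≤ (1 / 2 : ℝ) ^ (N / (2 * Q)) * (N : ℝ) ^ 3 := by positivity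
  calc (1 / 2 : ℝ) ^ (N / Q) * Real.exp (15 * Real.sqrt N) * (N : ℝ) ^ 3
      ≤ ((1 / 2 : ℝ) ^ (N / (2 * Q)) * (1 / 2 : ℝ) ^ (N / (2 * Q))) * Real.exp (15 * Real.sqrt N) * (N : ℝ) ^ 3 :=
        by gcongr
    _ = ((1 / 2 : ℝ) ^ (N / (2 * Q)) * Real.exp (15 * Real.sqrt N)) * ((1 / 2 : ℝ) ^ (N / (2 * Q)) * (N : ℝ) ^ 3) :=
        by ring
    _ ≤ 1 * (27 * ((2 * Q : ℕ) : ℝ) ^ 3) := mul_le_mul h1 h2 hB zero_le_one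
    _ = 216 * (Q : ℝ) ^ 3 := by push_cast; ring

/-! ### (P3) for bridges -/

/-- **(P3) for bridges**: with `a := 1/(4Q)` from the all-walk detour density, for all large `N` the bridges with
`J(ω) < aN` number at most `C · b_N(𝕋)/N³` — they are at most `C₀ 2^{−⌊N/Q⌋} μ(𝕋)^N` (all walks), and
`μ(𝕋)^N ≤ e^{15√N} b_N(𝕋)` (Hammersley–Welsh lower envelope for bridges), with the tail
`2^{−⌊N/Q⌋} e^{15√N} ≤ 216 Q³/N³`. [cite: MadrasSlade1993, §7.3 (7.3.9)–(7.3.10) and Theorem 7.3.4(d)] -/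
theorem triBridgeKesten_P3 :
    ∃ a > (0 : ℝ), ∃ C ≥ (0 : ℝ), ∃ N₁ : ℕ, ∀ N, N₁ ≤ N → 1 ≤ N →
      (#((triBL N).filter fun ω => (#(triSharp ω) : ℝ) < a * N) : ℝ) ≤ C * #(triBL N) / (N : ℝ) ^ 3 := by
  classical
  obtain ⟨Q, hQ, C₀, hC₀⟩ := detourDensityTri
  have hQr : (0 : ℝ) < Q := by exact_mod_cast hQ
  refine ⟨1 / (4 * Q), by positivity, 216 * (Q : ℝ) ^ 3 * max C₀ 0, by positivity, (31 * (2 * Q)) ^ 2,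
    fun N hN1 hN => ?_⟩
  have hNr : (0 : ℝ) < N := by exact_mod_cast hN
  -- Step 1: the filter (over bridges) is contained in the all-walk density event
  have hsub : #((triBL N).filter fun ω => (#(triSharp ω) : ℝ) < 1 / (4 * (Q : ℝ)) * N) ≤
      {l : List (Site 2) | l ∈ sawLists triGraph (0 : Site 2) N ∧ detourCount l ≤ N / (4 * Q)}.ncard := by
    rw [← Set.ncard_coe_finset]
    refine Set.ncard_le_ncard ?_ ((sawLists_finite triGraph (0 : Site 2) N).subset fun l hl => hl.1)
    intro ω hω
    rw [Finset.coe_filter, Set.mem_setOf_eq, mem_triBL, mem_triSL] at hω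
    refine ⟨hω.1.1, ?_⟩
    rw [← card_triSharp_eq_detourCount, Nat.le_div_iff_mul_le (by positivity)]
    have h' := hω.2
    rw [div_mul_eq_mul_div, one_mul, lt_div_iff₀ (by positivity)] at h'
    exact_mod_cast h'.le
  -- Step 2: the density bound and the bridge lower envelope `μ^N ≤ e^{15√N} b_N`
  have hhalf : (0 : ℝ) ≤ (1 / 2 : ℝ) ^ (N / Q) := by positivity
  have hμ : (0 : ℝ) ≤ Real.exp logMuTri ^ N := by positivity
  have henv : Real.exp logMuTri ^ N ≤ Real.exp (15 * Real.sqrt N) * brickBridgeCount N := by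
    have h := exp_neg_mul_pow_le_brickBridgeCount N
    have he : Real.exp (15 * Real.sqrt N) * (Real.exp (-(15 * Real.sqrt N)) * Real.exp logMuTri ^ N) =
        Real.exp logMuTri ^ N := by
      rw [← mul_assoc, ← Real.exp_add, add_neg_cancel, Real.exp_zero, one_mul]
    rw [← he]
    exact mul_le_mul_of_nonneg_left h (Real.exp_nonneg _)
  have step2 : (#((triBL N).filter fun ω => (#(triSharp ω) : ℝ) < 1 / (4 * (Q : ℝ)) * N) : ℝ) ≤
      max C₀ 0 * ((1 / 2 : ℝ) ^ (N / Q) * Real.exp (15 * Real.sqrt N)) * brickBridgeCount N := by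
    calc (#((triBL N).filter fun ω => (#(triSharp ω) : ℝ) < 1 / (4 * (Q : ℝ)) * N) : ℝ)
        ≤ (({l : List (Site 2) | l ∈ sawLists triGraph (0 : Site 2) N ∧
            detourCount l ≤ N / (4 * Q)}.ncard : ℕ) : ℝ) := by exact_mod_cast hsub
      _ ≤ C₀ * (1 / 2 : ℝ) ^ (N / Q) * Real.exp logMuTri ^ N := hC₀ N
      _ ≤ max C₀ 0 * (1 / 2 : ℝ) ^ (N / Q) * Real.exp logMuTri ^ N :=
          mul_le_mul_of_nonneg_right (mul_le_mul_of_nonneg_right (le_max_left _ _) hhalf) hμ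
      _ ≤ max C₀ 0 * (1 / 2 : ℝ) ^ (N / Q) * (Real.exp (15 * Real.sqrt N) * brickBridgeCount N) :=
          mul_le_mul_of_nonneg_left henv (mul_nonneg (le_max_right _ _) hhalf)
      _ = max C₀ 0 * ((1 / 2 : ℝ) ^ (N / Q) * Real.exp (15 * Real.sqrt N)) * brickBridgeCount N := by ring
  -- Step 3: the tail
  have htail : (1 / 2 : ℝ) ^ (N / Q) * Real.exp (15 * Real.sqrt N) ≤ 216 * (Q : ℝ) ^ 3 / (N : ℝ) ^ 3 := by
    rw [le_div_iff₀ (by positivity)]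
    exact half_pow_mul_exp_sqrt_mul_cube_le hQ hN1
  have hb : (0 : ℝ) ≤ brickBridgeCount N := Nat.cast_nonneg _
  rw [card_triBL]
  calc (#((triBL N).filter fun ω => (#(triSharp ω) : ℝ) < 1 / (4 * (Q : ℝ)) * N) : ℝ)
      ≤ max C₀ 0 * ((1 / 2 : ℝ) ^ (N / Q) * Real.exp (15 * Real.sqrt N)) * brickBridgeCount N := step2
    _ ≤ max C₀ 0 * (216 * (Q : ℝ) ^ 3 / (N : ℝ) ^ 3) * brickBridgeCount N :=
        mul_le_mul_of_nonneg_right (mul_le_mul_of_nonneg_left htail (le_max_right _ _)) hb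
    _ = 216 * (Q : ℝ) ^ 3 * max C₀ 0 * (brickBridgeCount N : ℝ) / (N : ℝ) ^ 3 := by
        field_simp

/-! ### (iii) Kesten's inequality for bridges of `𝕋` -/

/-- **Kesten's inequality for the bridges of `𝕋`**: there is `D` with
`(b_{N+1}/b_N)² − D/N ≤ (b_{N+1}/b_N)(b_{N+2}/b_{N+1})` for all large `N` — the abstract inequality without
growth hypothesis, fed with the bridge transfer counts (P1), (P2) and the bridge density (P3).
[cite: MadrasSlade1993, Theorem 7.3.2 (proof) and Theorem 7.3.4(d)] -/
theorem kestenIneqTriBridge : ∃ D : ℝ, ∀ᶠ N : ℕ in atTop,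
    ((brickBridgeCount (N + 1) : ℝ) / brickBridgeCount N) ^ 2 - D / N ≤
      ((brickBridgeCount (N + 1) : ℝ) / brickBridgeCount N) *
        ((brickBridgeCount (N + 2) : ℝ) / brickBridgeCount (N + 1)) := by
  obtain ⟨a, ha, C, hC0, N₁, hC⟩ := triBridgeKesten_P3
  have key := kesten_ineq_of_transfer_noGrowth (α := List (Site 2)) triBL (fun _ ω => #(triBSlots ω))
    (fun _ ω => #(triSharp ω)) N₁ (a := a) (C := C) (c₁ := 2) (c₂ := 8) (c₃ := 5)
    (c₄ := 2) ha hC0 (by norm_num) (by norm_num) (by norm_num) (by norm_num)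
    (fun N _ => one_le_card_triBL N)
    (fun N _ ω hω => by
      have h := card_triBSlots_le hω
      calc ((#(triBSlots ω) : ℕ) : ℝ) ≤ ((2 * N : ℕ) : ℝ) := by exact_mod_cast h
        _ = 2 * (N : ℝ) := by push_cast; ring)
    (fun N _ => (triBridgeKesten_P1' N))
    (fun N _ => by
      -- (P2): termwise `I(I−8)/((J+5)(J+6)) ≤ I·max 0 (I−8)/((J+3)(J+6))`
      rw [card_triBL]
      refine le_trans (sum_le_sum fun ω _ => ?_) (triBridgeKesten_P2 N)
      set I : ℝ := (#(triBSlots ω) : ℝ)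
      set J : ℝ := (#(triSharp ω) : ℝ)
      have hI0 : 0 ≤ I := Nat.cast_nonneg _
      have hJ0 : 0 ≤ J := Nat.cast_nonneg _
      have hden : 0 < (J + 3) * (J + 6) := by positivity
      have hden' : 0 < (J + 5) * (J + 5 + 1) := by positivity
      by_cases h8 : 8 ≤ I
      · have hmax : max 0 (I - 8) = I - 8 := max_eq_right (by linarith)
        rw [hmax]
        apply div_le_div_of_nonneg_left (by nlinarith) hden
        nlinarith
      · have hneg : I * (I - 8) / ((J + 5) * (J + 5 + 1)) ≤ 0 :=
          div_nonpos_of_nonpos_of_nonneg (by nlinarith) hden'.le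
        have hpos : 0 ≤ I * max 0 (I - 8) / ((J + 3) * (J + 6)) := by positivity
        linarith)
    (fun N hN₁ hN => hC N hN₁ hN)
  obtain ⟨D, hD⟩ := key
  refine ⟨D, ?_⟩
  filter_upwards [hD] with N h
  simpa only [card_triBL] using h

/-! ### The ratio limit -/

/-- **`b_{N+1}(𝕋)/b_N(𝕋) → μ(𝕋)`** — Madras–Slade Theorem 7.3.4(d) for the triangular lattice, one-step and
without renewal theory: (i) `b_N^{1/N} → μ(𝕋)` (Hammersley–Welsh on `𝕋`), (ii) `b_{N+1} ≥ b_N`, (iii)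
`kestenIneqTriBridge`, assembled by the tree's one-step Lemma 7.3.1 `Zd.tendsto_ratio_of_kesten_one`. Printed
for `ℤ^d` only; for `𝕋` not located in print. [cite: MadrasSlade1993, Theorem 7.3.4(d) and Lemma 7.3.1] -/
theorem tendsto_brickBridgeCount_ratio :
    Tendsto (fun N : ℕ => (brickBridgeCount (N + 1) : ℝ) / brickBridgeCount N) atTop
      (𝓝 (Real.exp logMuTri)) := by
  have hb : ∀ n, (0 : ℝ) < brickBridgeCount n := fun n => by exact_mod_cast one_le_brickBridgeCount n
  refine Zd.tendsto_ratio_of_kesten_one (Real.exp_pos _) hb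
    (logMuTriBridge_eq_logMuTri ▸ tendsto_brickBridgeCount_rpow) ?_ kestenIneqTriBridge
  refine ⟨1, one_pos, Eventually.of_forall fun n => ?_⟩
  rw [le_div_iff₀ (hb n), one_mul]
  exact_mod_cast brickBridgeCount_le_succ n

/-- The bridge ratio of `𝕋` in list-count form: `#B_{N+1}(𝕋)/#B_N(𝕋) → μ(𝕋)`. [cite: MadrasSlade1993, Theorem 7.3.4(d)] -/
theorem tendsto_card_triBL_ratio :
    Tendsto (fun N : ℕ => (#(triBL (N + 1)) : ℝ) / #(triBL N)) atTop (𝓝 (Real.exp logMuTri)) := by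
  simpa only [card_triBL] using tendsto_brickBridgeCount_ratio

end Literature.Probability.RandomPlanarGeometry.SAW
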